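import Summits.HodgeConjecture.HodgeConjecture.Theorems.F0P3XiUnramNonsplitInstance
import Literature.NumberTheory.Automorphic.TorusCharacterLocalComponents
import Literature.NumberTheory.Automorphic.GKModulesAdmissible
import Literature.NumberTheory.Rogawski1990.GlobalAPacketMembership
import HarnessLib

/-!
# THE ξ-LOCAL FAMILY OF RECORD `packFin₀ ξ` of the T5 kit `𝔠₀` (I): definition and law `xiFamilyFin` — Rogawski §12.2, §13.1

Cell `hodgecm-mathlib`, F0∕P3 «U3-mult», crux H413 (`stmt-HodgeConjecture-24833`), rung 4, PLAN.F0P3g4 §24 Z7 (β) ∕ ADDENDUM 1 §28.3 ∕ RULINGS (V24)(c),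
(V25)(1) (F0P3-p01 (g7)).  DEF LANE: ONE definition (`xiFamilyOfRecord`) + theorems; no instance, no notation, no named fact, no `sorry`.  Part (II)
(`Theorems/F0P3XiLocalFamilyOfRecordUnram.lean`) proves law `XiUnram` off a finite set `ramOfRecord ξ`.  At ED. 4 of the T5 line
`F0_T5InnerFormClassification` the kit `𝔠₀` reads `packFin₀ ξ := xiFamilyOfRecord … ξ` and law `xiFamilyFin` := `isXiLocalFamily_xiFamilyOfRecord(_of_nontrivial)`.

THE RECORD.  For a one-dimensional automorphic `ξ` of `U(H)` (★ `OneDimAutRepH`), the hermitian frame `(H, hH, hHd)` and Rogawski's auxiliary unitary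
Hecke character `μ = μω`, `xiFamilyOfRecord ξ : ∀ v, CMLocalAPacket L H v` is, at each finite place `v` of `L⁺`:
* `v` SPLIT in `L`: ★ D6's split packet `{i_G(ξ_v ⊗ μ_w ∘ det₀)} = cmSplitPacket …` at the FIXED witness `w = splitWitness v hs` (the split clause of ★
  `OneDimAutRepH.IsXiLocalFamily` verbatim) [Rogawski1990 §13.1 p. 199; Lemma 4.13.1 (b)];
* `v` NON-SPLIT: `⟨x ∘ e, none⟩` with `e = (cmDatumLocalCongr L v T ha h)⁻¹ : U(H)(L⁺_v) ≃ U(Φ₃)(L⁺_v)` a FORM CONGRUENCE (D6's non-split clause), chosen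
  LEVEL-MATCHING (`e⁻¹(U(Φ₃)(𝒪_v)) = U(H)(𝒪_v)`) whenever one exists — at all but finitely many `v`, ★ p818229 `eventually_exists_cmDatumLocalCongr_levelMatching_three`
  (B-p08 (g19)) — and `x` a constituent of `i_G(χ_ξ,v)` (`χ_ξ,v = cmXiTorusChar (μ_v, η_v, ψ_v)`) as soon as one exists, chosen ADMISSIBLE and
  `K_v`-SPHERICAL whenever such a constituent exists — it does when `χ_ξ,v` is unramified, ★ p817760 `exists_spherical_constituent` (B-p08 (g19)); Rogawski's
  `πⁿ(ξ_v)` [§12.2 pp. 173–174].  No second member is recorded (`πˢ := none`; the supercuspidal `πˢ(ξ_v)` enters T5 only through the envelope).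

CONTENTS.  `nonempty_irrClass` (junk value); `exists_congrOfRecordAt`, `exists_constituentOfRecord` (the two classical choices); **`exists_packetOfRecordAt`**;
the definition **`xiFamilyOfRecord`** + `xiFamilyOfRecord_spec` ∕ `xiFamilyOfRecord_of_split`; **`isXiLocalFamily_xiFamilyOfRecord (hcon)`** ∕
`…_of_nontrivial (hnt)` — law `xiFamilyFin`, CONDITIONAL on ONE visible hypothesis: `i_G(χ_ξ,v)` has a constituent (resp. is non-zero) at every NON-SPLIT
`v` (automatic off the finitely many `v` with `χ_ξ,v` ramified, Part (II); the ramified non-split places wait for «`i_B^G(χ) ≠ 0`», ★-to-be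
`SmoothInductionNontrivial`, RULING (V25)(1) (G1)).

ELABORATION NOTE.  Every mention of ★ `cmPrincipalSeries L 3 v χ` costs ≈ 37k heartbeats to elaborate (measured with `#count_heartbeats`); the
declarations whose statements spell D6's non-split clause several times carry `set_option maxHeartbeats 800000 in`.

References: [Rogawski1990] §4.13 p. 62 Lemma 4.13.1 (b), §12.2 pp. 173–174, §13.1 p. 199, §14.2 pp. 232–233; [CartierCorvallis1979] §IV.1; [BernsteinZelevinsky1976]
§2.3; [BushnellHenniart2006] §1.1, §2; [Jacobowitz1962] Thm. 3.1.
HC_CM is proved only modulo the printed citations until rung 0 closes.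
-/

set_option autoImplicit false
set_option linter.dupNamespace false

noncomputable section

open NumberField IsDedekindDomain MeasureTheory Filter Topology
open scoped Matrix MatrixGroups

namespace Summit.HodgeConjecture.HodgeConjecture.Cruxes.H413.F0P3XiLocalFamilyOfRecord

open Literature.NumberTheory Literature.NumberTheory.Automorphic Literature.NumberTheory.Automorphic.UnitaryGroup
open Literature.NumberTheory.Rogawski1990 Literature.NumberTheory.GaloisRepresentations
open Literature.NumberTheory.Automorphic.Arthur2013.Leaves.TECR

/-! ## §3 The ξ-local family OF RECORD: existence place by place, the definition, the D6 law `xiFamilyFin` -/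

section Record

/-- `Irr(G)` is non-empty (the class of the trivial character) — the junk value of the record at a place where no constituent is known. [cite: BushnellHenniart2006, §1.1] -/
theorem nonempty_irrClass (G : Type) [Group G] [TopologicalSpace G] : Nonempty (IrrClass G) :=
  ⟨IrrClass.mk
    { V := ℂ
      ρ := Representation.trivial ℂ G ℂ
      isIrreducible := isIrreducible_trivial_self ℂ G
      isSmooth := Representation.isSmooth_trivial }⟩

variable (L : Type) [Field L] [NumberField L] [IsCMField L] (H : Matrix (Fin 3) (Fin 3) L)
  (hH : (H.map (cmConjRingHom L))ᵀ = H) (hHd : IsUnit H.det) (μω : HeckeCharacter L) (hμu : μω.IsUnitary)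

include hH hHd in
/-- **Non-split places: the CONGRUENCE of record** — level-matching whenever a level-matching form congruence exists, else ★
`exists_formCongr_eq_smul_antidiag`. [cite: Rogawski1990, §14.2 pp. 232–233] [cite: Jacobowitz1962, Thm. 3.1] -/
theorem exists_congrOfRecordAt (v : HeightOneSpectrum (𝓞 ↥(maximalRealSubfield L)))
    (hns : ∀ w : PlacesOver L v, IsCMField.complexConj L • w.1 = w.1) :
    ∃ (T : GL (Fin 3) (LocalRing L v)) (a : LocalRing L v) (ha : IsUnit a)
          (h : formCongr (conjLocal L (IsCMField.complexConj L) v) T (H.map (algebraMap L (LocalRing L v))) =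
            a • (Matrix.of fun i j : Fin 3 => if i.val + j.val + 1 = 3 then (1 : L) else 0).map (algebraMap L (LocalRing L v))),
      (∃ (T' : GL (Fin 3) (LocalRing L v)) (a' : LocalRing L v) (ha' : IsUnit a')
          (h' : formCongr (conjLocal L (IsCMField.complexConj L) v) T' (H.map (algebraMap L (LocalRing L v))) =
            a' • (Matrix.of fun i j : Fin 3 => if i.val + j.val + 1 = 3 then (1 : L) else 0).map (algebraMap L (LocalRing L v))),
            ∀ g : (cmDatum L 3 H).Local v, (cmDatumLocalCongr L v T' ha' h').symm g ∈ cmLocalIntegralLevel L 3 (qsForm L) v ↔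
              g ∈ cmLocalIntegralLevel L 3 H v) →
        ∀ g : (cmDatum L 3 H).Local v, (cmDatumLocalCongr L v T ha h).symm g ∈ cmLocalIntegralLevel L 3 (qsForm L) v ↔
              g ∈ cmLocalIntegralLevel L 3 H v := by
  rcases Classical.em (∃ (T' : GL (Fin 3) (LocalRing L v)) (a' : LocalRing L v) (ha' : IsUnit a')
          (h' : formCongr (conjLocal L (IsCMField.complexConj L) v) T' (H.map (algebraMap L (LocalRing L v))) =
            a' • (Matrix.of fun i j : Fin 3 => if i.val + j.val + 1 = 3 then (1 : L) else 0).map (algebraMap L (LocalRing L v))),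
            ∀ g : (cmDatum L 3 H).Local v, (cmDatumLocalCongr L v T' ha' h').symm g ∈ cmLocalIntegralLevel L 3 (qsForm L) v ↔
              g ∈ cmLocalIntegralLevel L 3 H v) with hlm | hlm
  · obtain ⟨T, a, ha, h, hT⟩ := hlm
    exact ⟨T, a, ha, h, fun _ => hT⟩
  · obtain ⟨T, a, ha, h⟩ := exists_formCongr_eq_smul_antidiag (L := L) (H := H) hH hHd v hns
    exact ⟨T, a, ha, h, fun h' => absurd h' hlm⟩

/-- **The CONSTITUENT of record (generic choice)**: for any representation `ρ` and level `K`, a class which IS a constituent of `ρ` as soon as `ρ`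
has one, and IS admissible and `K`-spherical as soon as `ρ` has such a constituent; else a junk class (`nonempty_irrClass`).  Instantiated below at
`ρ = i_G(χ_ξ,v)`, `K = K_v` (★ p817760 supplies the admissible spherical constituent for unramified `χ_ξ,v`). [cite: Rogawski1990, §12.2 pp. 173–174]
[cite: CartierCorvallis1979, §IV.1] -/
theorem exists_constituentOfRecord {G : Type} [Group G] [TopologicalSpace G] {V : Type} [AddCommGroup V] [Module ℂ V]
    (ρ : Representation ℂ G V) (K : Subgroup G) :
    ∃ x : IrrClass G,
      ((∃ x' : IrrClass G, x'.IsConstituentOf ρ) → x.IsConstituentOf ρ) ∧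
      ((∃ x' : IrrClass G, x'.IsConstituentOf ρ ∧ x'.IsAdmissible ∧ x'.IsSpherical K) → x.IsAdmissible ∧ x.IsSpherical K) := by
  rcases Classical.em (∃ x' : IrrClass G, x'.IsConstituentOf ρ ∧ x'.IsAdmissible ∧ x'.IsSpherical K) with hsph | hsph
  · obtain ⟨x, hx, hadm, h1⟩ := hsph
    exact ⟨x, fun _ => hx, fun _ => ⟨hadm, h1⟩⟩
  · rcases Classical.em (∃ x' : IrrClass G, x'.IsConstituentOf ρ) with hcon | hcon
    · obtain ⟨x, hx⟩ := hcon
      exact ⟨x, fun _ => hx, fun h' => absurd h' hsph⟩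
    · obtain ⟨x⟩ := nonempty_irrClass G
      exact ⟨x, fun h' => absurd h' hcon, fun h' => absurd h' hsph⟩

set_option maxHeartbeats 800000 in -- each mention of `cmPrincipalSeries L 3 v χ` costs ≈ 37k heartbeats to elaborate (measured); the statement has five
/-- **THE RECORD AT ONE PLACE EXISTS.**  At `v` there is a packet `P` such that: (S) if `v` splits, `P` IS ★ D6's split packet at the fixed
witness (verbatim the split clause of ★ `IsXiLocalFamily`); (N) if `v` is non-split, `P = ⟨x ∘ e, none⟩` with
`e = (cmDatumLocalCongr L v T ha h)⁻¹` a FORM CONGRUENCE (the non-split clause of ★ `IsXiLocalFamily`) chosen LEVEL-MATCHING whenever a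
level-matching one exists, and `x` a constituent of `i_G(χ_ξ,v)` as soon as one exists, chosen ADMISSIBLE and `K_v`-SPHERICAL whenever such a
constituent exists. [cite: Rogawski1990, §13.1 p. 199; §12.2 pp. 173–174; §14.2 p. 232] [cite: CartierCorvallis1979, §IV.1] -/
theorem exists_packetOfRecordAt (ξ : OneDimAutRepH L) (v : HeightOneSpectrum (𝓞 ↥(maximalRealSubfield L))) :
    ∃ P : CMLocalAPacket L H v,
      (∀ hs : ∃ w : PlacesOver L v, IsCMField.complexConj L • w.1 ≠ w.1,
        P = cmSplitPacket L H hH hHd v (splitWitness v hs) (splitWitness_spec v hs) (ξ.splitν₀ μω (splitWitness v hs).1)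
          (ξ.locψ (splitWitness v hs).1) (ξ.norm_splitν₀_apply hμu (splitWitness v hs).1)
          (ξ.continuous_splitν₀ μω (splitWitness v hs).1) (ξ.norm_locψ_apply (splitWitness v hs).1)
          (ξ.continuous_locψ (splitWitness v hs).1)) ∧
      ((∀ w : PlacesOver L v, IsCMField.complexConj L • w.1 = w.1) →
        ∃ (T : GL (Fin 3) (LocalRing L v)) (a : LocalRing L v) (ha : IsUnit a)
          (h : formCongr (conjLocal L (IsCMField.complexConj L) v) T (H.map (algebraMap L (LocalRing L v))) =
            a • (Matrix.of fun i j : Fin 3 => if i.val + j.val + 1 = 3 then (1 : L) else 0).map (algebraMap L (LocalRing L v)))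
          (x : IrrClass (Gqs L v)),
          P = ⟨IrrClass.comap (cmDatumLocalCongr L v T ha h).symm x, none⟩ ∧
          ((∃ x : IrrClass (Gqs L v), x.IsConstituentOf (cmPrincipalSeries L 3 v (cmXiTorusChar L v (μω.semilocalComponent L v)
          (torusLocalComponent L (IsCMField.complexConj L) v ξ.η) (torusLocalComponent L (IsCMField.complexConj L) v ξ.ψ)))) →
            x.IsConstituentOf (cmPrincipalSeries L 3 v (cmXiTorusChar L v (μω.semilocalComponent L v)
          (torusLocalComponent L (IsCMField.complexConj L) v ξ.η) (torusLocalComponent L (IsCMField.complexConj L) v ξ.ψ)))) ∧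
          ((∃ (T' : GL (Fin 3) (LocalRing L v)) (a' : LocalRing L v) (ha' : IsUnit a')
          (h' : formCongr (conjLocal L (IsCMField.complexConj L) v) T' (H.map (algebraMap L (LocalRing L v))) =
            a' • (Matrix.of fun i j : Fin 3 => if i.val + j.val + 1 = 3 then (1 : L) else 0).map (algebraMap L (LocalRing L v))),
            ∀ g : (cmDatum L 3 H).Local v, (cmDatumLocalCongr L v T' ha' h').symm g ∈ cmLocalIntegralLevel L 3 (qsForm L) v ↔
              g ∈ cmLocalIntegralLevel L 3 H v) →
            ∀ g : (cmDatum L 3 H).Local v, (cmDatumLocalCongr L v T ha h).symm g ∈ cmLocalIntegralLevel L 3 (qsForm L) v ↔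
              g ∈ cmLocalIntegralLevel L 3 H v) ∧
          ((∃ x' : IrrClass (Gqs L v), x'.IsConstituentOf (cmPrincipalSeries L 3 v (cmXiTorusChar L v (μω.semilocalComponent L v)
          (torusLocalComponent L (IsCMField.complexConj L) v ξ.η) (torusLocalComponent L (IsCMField.complexConj L) v ξ.ψ))) ∧
              x'.IsAdmissible ∧ x'.IsSpherical (cmLocalIntegralLevel L 3 (qsForm L) v)) →
            x.IsAdmissible ∧ x.IsSpherical (cmLocalIntegralLevel L 3 (qsForm L) v))) := by
  rcases Classical.em (∃ w : PlacesOver L v, IsCMField.complexConj L • w.1 ≠ w.1) with hs | hs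
  · -- SPLIT: the D6 split packet (as a function of the splitting witness-proof, so that (S) is proof irrelevance); (N) is vacuous
    refine ⟨_, fun hs' => congrArg (fun hs'' : (∃ w : PlacesOver L v, IsCMField.complexConj L • w.1 ≠ w.1) =>
      cmSplitPacket L H hH hHd v (splitWitness v hs'') (splitWitness_spec v hs'') (ξ.splitν₀ μω (splitWitness v hs'').1)
          (ξ.locψ (splitWitness v hs'').1) (ξ.norm_splitν₀_apply hμu (splitWitness v hs'').1)
          (ξ.continuous_splitν₀ μω (splitWitness v hs'').1) (ξ.norm_locψ_apply (splitWitness v hs'').1)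
          (ξ.continuous_locψ (splitWitness v hs'').1)) (Subsingleton.elim hs hs'), fun hns => ?_⟩
    obtain ⟨w, hw⟩ := hs
    exact absurd (hns w) hw
  · -- NON-SPLIT
    have hns : ∀ w : PlacesOver L v, IsCMField.complexConj L • w.1 = w.1 := fun w => not_not.1 fun hw => hs ⟨w, hw⟩
    obtain ⟨T, a, ha, h, hT⟩ := exists_congrOfRecordAt L H hH hHd v hns
    obtain ⟨x, hx, hxs⟩ := exists_constituentOfRecord (G := Gqs L v) (cmPrincipalSeries L 3 v (cmXiTorusChar L v
      (μω.semilocalComponent L v) (torusLocalComponent L (IsCMField.complexConj L) v ξ.η)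
      (torusLocalComponent L (IsCMField.complexConj L) v ξ.ψ))) (cmLocalIntegralLevel L 3 (qsForm L) v)
    exact ⟨⟨IrrClass.comap (cmDatumLocalCongr L v T ha h).symm x, none⟩, fun hs' => absurd hs' hs,
      fun _ => ⟨T, a, ha, h, x, rfl, hx, hT, hxs⟩⟩

/-- **THE ξ-LOCAL FAMILY OF RECORD** `packFin₀ ξ` of the T5 kit `𝔠₀` (PLAN.F0P3g4 ADDENDUM 1 §28.3; RULING (V24)(c)): at each finite place `v` of
`L⁺` THE packet chosen by `exists_packetOfRecordAt` — at a split `v` the D6 split packet `{i_G(ξ_v ⊗ μ_w ∘ det₀)}` at the fixed witness; at a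
non-split `v` the pair `⟨x ∘ e, none⟩` with `e` a form congruence `U(H)(L⁺_v) ≃ U(Φ₃)(L⁺_v)` (level-matching when possible) and `x` a constituent
of `i_G(χ_ξ,v)` (the admissible `K_v`-spherical one when it exists — Rogawski's `πⁿ(ξ_v)` at unramified `v`).  No second member is recorded
(`πˢ := none`): the kit's expansion reads the supercuspidal member only through the envelope. [cite: Rogawski1990, §13.1 p. 199; §12.2 pp. 173–174;
§4.13 Lemma 4.13.1 (b)] -/
def xiFamilyOfRecord (ξ : OneDimAutRepH L) : ∀ v : HeightOneSpectrum (𝓞 ↥(maximalRealSubfield L)), CMLocalAPacket L H v :=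
  fun v => (exists_packetOfRecordAt L H hH hHd μω hμu ξ v).choose

set_option maxHeartbeats 800000 in -- see `exists_packetOfRecordAt`
/-- The defining property of the record at `v` (both clauses of `exists_packetOfRecordAt`). [cite: Rogawski1990, §13.1 p. 199] -/
theorem xiFamilyOfRecord_spec (ξ : OneDimAutRepH L) (v : HeightOneSpectrum (𝓞 ↥(maximalRealSubfield L))) :
    (∀ hs : ∃ w : PlacesOver L v, IsCMField.complexConj L • w.1 ≠ w.1,
        xiFamilyOfRecord L H hH hHd μω hμu ξ v = cmSplitPacket L H hH hHd v (splitWitness v hs) (splitWitness_spec v hs)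
          (ξ.splitν₀ μω (splitWitness v hs).1) (ξ.locψ (splitWitness v hs).1) (ξ.norm_splitν₀_apply hμu (splitWitness v hs).1)
          (ξ.continuous_splitν₀ μω (splitWitness v hs).1) (ξ.norm_locψ_apply (splitWitness v hs).1)
          (ξ.continuous_locψ (splitWitness v hs).1)) ∧
      ((∀ w : PlacesOver L v, IsCMField.complexConj L • w.1 = w.1) →
        ∃ (T : GL (Fin 3) (LocalRing L v)) (a : LocalRing L v) (ha : IsUnit a)
          (h : formCongr (conjLocal L (IsCMField.complexConj L) v) T (H.map (algebraMap L (LocalRing L v))) =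
            a • (Matrix.of fun i j : Fin 3 => if i.val + j.val + 1 = 3 then (1 : L) else 0).map (algebraMap L (LocalRing L v)))
          (x : IrrClass (Gqs L v)),
          xiFamilyOfRecord L H hH hHd μω hμu ξ v = ⟨IrrClass.comap (cmDatumLocalCongr L v T ha h).symm x, none⟩ ∧
          ((∃ x : IrrClass (Gqs L v), x.IsConstituentOf (cmPrincipalSeries L 3 v (cmXiTorusChar L v (μω.semilocalComponent L v)
          (torusLocalComponent L (IsCMField.complexConj L) v ξ.η) (torusLocalComponent L (IsCMField.complexConj L) v ξ.ψ)))) →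
            x.IsConstituentOf (cmPrincipalSeries L 3 v (cmXiTorusChar L v (μω.semilocalComponent L v)
          (torusLocalComponent L (IsCMField.complexConj L) v ξ.η) (torusLocalComponent L (IsCMField.complexConj L) v ξ.ψ)))) ∧
          ((∃ (T' : GL (Fin 3) (LocalRing L v)) (a' : LocalRing L v) (ha' : IsUnit a')
              (h' : formCongr (conjLocal L (IsCMField.complexConj L) v) T' (H.map (algebraMap L (LocalRing L v))) =
                a' • (Matrix.of fun i j : Fin 3 => if i.val + j.val + 1 = 3 then (1 : L) else 0).map (algebraMap L (LocalRing L v))),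
              ∀ g : (cmDatum L 3 H).Local v, (cmDatumLocalCongr L v T' ha' h').symm g ∈ cmLocalIntegralLevel L 3 (qsForm L) v ↔
                g ∈ cmLocalIntegralLevel L 3 H v) →
            ∀ g : (cmDatum L 3 H).Local v, (cmDatumLocalCongr L v T ha h).symm g ∈ cmLocalIntegralLevel L 3 (qsForm L) v ↔
              g ∈ cmLocalIntegralLevel L 3 H v) ∧
          ((∃ x' : IrrClass (Gqs L v), x'.IsConstituentOf (cmPrincipalSeries L 3 v (cmXiTorusChar L v (μω.semilocalComponent L v)
              (torusLocalComponent L (IsCMField.complexConj L) v ξ.η) (torusLocalComponent L (IsCMField.complexConj L) v ξ.ψ))) ∧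
              x'.IsAdmissible ∧ x'.IsSpherical (cmLocalIntegralLevel L 3 (qsForm L) v)) →
            x.IsAdmissible ∧ x.IsSpherical (cmLocalIntegralLevel L 3 (qsForm L) v))) :=
  (exists_packetOfRecordAt L H hH hHd μω hμu ξ v).choose_spec

/-- **At a split place the record IS the D6 split packet at the fixed witness.** [cite: Rogawski1990, §13.1 p. 199; §4.13 Lemma 4.13.1 (b)] -/
theorem xiFamilyOfRecord_of_split (ξ : OneDimAutRepH L) (v : HeightOneSpectrum (𝓞 ↥(maximalRealSubfield L)))
    (hs : ∃ w : PlacesOver L v, IsCMField.complexConj L • w.1 ≠ w.1) :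
    xiFamilyOfRecord L H hH hHd μω hμu ξ v = cmSplitPacket L H hH hHd v (splitWitness v hs) (splitWitness_spec v hs)
      (ξ.splitν₀ μω (splitWitness v hs).1) (ξ.locψ (splitWitness v hs).1) (ξ.norm_splitν₀_apply hμu (splitWitness v hs).1)
      (ξ.continuous_splitν₀ μω (splitWitness v hs).1) (ξ.norm_locψ_apply (splitWitness v hs).1)
      (ξ.continuous_locψ (splitWitness v hs).1) :=
  (xiFamilyOfRecord_spec L H hH hHd μω hμu ξ v).1 hs

set_option maxHeartbeats 800000 in -- see `exists_packetOfRecordAt`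
/-- **LAW `xiFamilyFin` AT 𝔠₀: the record IS a ξ-local family** (★ D6 `OneDimAutRepH.IsXiLocalFamily`), GIVEN that `i_G(χ_ξ,v)` has a constituent at
every non-split `v` (hypothesis `hcon`; automatic wherever `χ_ξ,v` is unramified, ★ p817760 — at the finitely many ramified non-split places it is
the non-vanishing of the ramified principal series of `U(Φ₃)`, not yet in the tree). [cite: Rogawski1990, §13.1 p. 199; §12.2 pp. 173–174; §14.2 p. 232] -/
theorem isXiLocalFamily_xiFamilyOfRecord (ξ : OneDimAutRepH L)
    (hcon : ∀ v : HeightOneSpectrum (𝓞 ↥(maximalRealSubfield L)), (∀ w : PlacesOver L v, IsCMField.complexConj L • w.1 = w.1) →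
      ∃ x : IrrClass (Gqs L v), x.IsConstituentOf (cmPrincipalSeries L 3 v (cmXiTorusChar L v (μω.semilocalComponent L v)
        (torusLocalComponent L (IsCMField.complexConj L) v ξ.η) (torusLocalComponent L (IsCMField.complexConj L) v ξ.ψ)))) :
    ξ.IsXiLocalFamily hH hHd μω hμu (xiFamilyOfRecord L H hH hHd μω hμu ξ) := by
  refine ⟨fun v hs => xiFamilyOfRecord_of_split L H hH hHd μω hμu ξ v hs, fun v hns => ?_⟩
  obtain ⟨T, a, ha, h, x, hP, hx, -, -⟩ := (xiFamilyOfRecord_spec L H hH hHd μω hμu ξ v).2 hns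
  exact ⟨T, a, ha, h, x, none, hP, hx (hcon v hns), fun c hc => by cases hc⟩

set_option maxHeartbeats 800000 in -- see `exists_packetOfRecordAt`
/-- **LAW `xiFamilyFin` AT 𝔠₀, `Nontrivial` form (RULING (V25)(1))**: the record is a ξ-local family as soon as `i_G(χ_ξ,v) ≠ 0` at every non-split `v`
(hypothesis `hnt`, stated on the carrier of ★ `cmPrincipalSeries` as ★ `IrrClass.exists_isConstituentOf` wants it; discharged by the non-vanishing of
principal series — ★-to-be `SmoothInductionNontrivial`, B-p08). [cite: Rogawski1990, §13.1 p. 199; §12.2 pp. 173–174] [cite: BernsteinZelevinsky1976, §2.3] -/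
theorem isXiLocalFamily_xiFamilyOfRecord_of_nontrivial (ξ : OneDimAutRepH L)
    (hnt : ∀ v : HeightOneSpectrum (𝓞 ↥(maximalRealSubfield L)), (∀ w : PlacesOver L v, IsCMField.complexConj L • w.1 = w.1) →
      Nontrivial (cmPrincipalSeries L 3 v (cmXiTorusChar L v (μω.semilocalComponent L v)
          (torusLocalComponent L (IsCMField.complexConj L) v ξ.η) (torusLocalComponent L (IsCMField.complexConj L) v ξ.ψ))).asModule) :
    ξ.IsXiLocalFamily hH hHd μω hμu (xiFamilyOfRecord L H hH hHd μω hμu ξ) := by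
  refine isXiLocalFamily_xiFamilyOfRecord L H hH hHd μω hμu ξ fun v hns => ?_
  have h := hnt v hns
  dsimp only [Representation.asModule] at h
  exact IrrClass.exists_isConstituentOf _ (F0P3XiUnramNonsplitInstance.isAdmissible_cmPrincipalSeries L v _).1

end Record

end Summit.HodgeConjecture.HodgeConjecture.Cruxes.H413.F0P3XiLocalFamilyOfRecord

end
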